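import Mathlib
import Literature.Computability.Complexity.HermitianSosRefutation
import Literature.Computability.AlgebraicComplexity.StandardFamilies
import Summits.ValiantsHypothesis.ValiantsHypothesis.Theorems.RefutationDegreeNsToSos

/-!
# The route's inlined Hermitian-SOS form, for line `Sketch` of crux `CertWindowQP` (stmt-ValiantsHypothesis-5640)

Stub `stub_sosRoute` of the registered skeleton. The route `RefutationDegree.CertWindowQP` inlines
"the determinantal-representability system `Rep(n,m)` has a Hermitian-SOS refutation with all
products of degree `≤ d`" as a `let`-block (`P` = defect `det(A₀ + ∑ x_e A_e) − per_n`,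
`eqn μ` = its `μ`-th `x`-coefficient lifted to the holomorphic copy `Sum.inl` of the doubled
unknowns, `cj` = conjugate the coefficients and swap the copies), with the axiom sum running over
`P.support` and the degree bound required for every `μ`. The Literature notion
`Literature.Computability.Complexity.HasHermitianSosRefutationOfDegree`
(`Literature/Computability/Complexity/HermitianSosRefutation.lean`) is the same identity over an
arbitrary finite set `s` of axioms (its `Fintype`-indexed "`∀ i`" form
`hasHermitianSosRefutationOfDegree_iff_forall` does not apply: the index type of all exponents
`μ : (Fin n × Fin n) →₀ ℕ` is infinite). The conversion for the coefficient system
`{P.coeff μ = 0}_μ` of an arbitrary `P` — keep the Hermitian squares, extend the multipliers by `0`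
off `s`; off `s` the multiplier vanishes and off `P.support` the axiom `P.coeff μ = 0` vanishes, so
the axiom sums over `P.support` and over `s` are both the sum over `s ∩ P.support` — is already in
the tree as `exists_sos_certificate_support_of_hasHermitianSosRefutationOfDegree_coeff`
(`Theorems/RefutationDegreeNsToSos.lean`, stated there for general `P` precisely so that
`CertWindowQP` can reuse it); this file specialises it VERBATIM to the body of the route decl at
fixed `n, m` with degree bound `d` (Lean sees through the route's `let`-block by `ζ`/`β`).
Nothing is restated; no named facts are used.
-/

namespace Summit.ValiantsHypothesis.ValiantsHypothesis.Theorems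

open Literature.Computability.AlgebraicComplexity Literature.Computability.Complexity

/-- **Stub `stub_sosRoute` of line `Sketch` (crux `CertWindowQP`, stmt-ValiantsHypothesis-5640).**
A Hermitian-SOS refutation of degree `≤ d` of the system `Rep(n,m) = {P.coeff μ = 0}_μ`,
`P = det(A₀ + ∑ x_e A_e) − per_n` over the `(n²+1)m²` unknown matrix entries, in the Literature
sense (`HasHermitianSosRefutationOfDegree`: a finite set `s` of axioms in play) yields VERBATIM the
body of the route decl `RefutationDegree.CertWindowQP` at fixed `n, m` with the degree bound `d`:
Hermitian squares `q i · cj (q i)`, multipliers `h μ` for every exponent `μ` with all products of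
total degree `≤ d`, and the identity with the axiom sum over `P.support` (same squares, multipliers
extended by `0` off `s`; `exists_sos_certificate_support_of_hasHermitianSosRefutationOfDegree_coeff`
seen through the route's `let`-block). [folklore] -/
theorem certWindowQP_sosRoute (n m d : ℕ)
    (h : HasHermitianSosRefutationOfDegree (fun μ : (Fin n × Fin n) →₀ ℕ =>
      ((Matrix.of fun i j : Fin m => MvPolynomial.C (MvPolynomial.X (none, (i, j))) + ∑ e : Fin n × Fin n, MvPolynomial.X e * MvPolynomial.C (MvPolynomial.X (some e, (i, j))) : Matrix (Fin m) (Fin m) (MvPolynomial (Fin n × Fin n) (MvPolynomial (Option (Fin n × Fin n) × (Fin m × Fin m)) ℂ))).det - MvPolynomial.map MvPolynomial.C (Literature.Computability.AlgebraicComplexity.perPoly (Fin n) ℂ)).coeff μ) d) :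
    (let P : MvPolynomial (Fin n × Fin n) (MvPolynomial (Option (Fin n × Fin n) × (Fin m × Fin m)) ℂ) := (Matrix.of fun i j : Fin m => MvPolynomial.C (MvPolynomial.X (none, (i, j))) + ∑ e : Fin n × Fin n, MvPolynomial.X e * MvPolynomial.C (MvPolynomial.X (some e, (i, j))) : Matrix (Fin m) (Fin m) (MvPolynomial (Fin n × Fin n) (MvPolynomial (Option (Fin n × Fin n) × (Fin m × Fin m)) ℂ))).det - MvPolynomial.map MvPolynomial.C (Literature.Computability.AlgebraicComplexity.perPoly (Fin n) ℂ); let eqn : ((Fin n × Fin n) →₀ ℕ) → MvPolynomial ((Option (Fin n × Fin n) × (Fin m × Fin m)) ⊕ (Option (Fin n × Fin n) × (Fin m × Fin m))) ℂ := fun μ => MvPolynomial.rename Sum.inl (P.coeff μ); let cj : MvPolynomial ((Option (Fin n × Fin n) × (Fin m × Fin m)) ⊕ (Option (Fin n × Fin n) × (Fin m × Fin m))) ℂ → MvPolynomial ((Option (Fin n × Fin n) × (Fin m × Fin m)) ⊕ (Option (Fin n × Fin n) × (Fin m × Fin m))) ℂ := fun p => MvPolynomial.rename Sum.swap (MvPolynomial.map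 (starRingEnd ℂ) p); ∃ (k : ℕ) (q : Fin k → MvPolynomial ((Option (Fin n × Fin n) × (Fin m × Fin m)) ⊕ (Option (Fin n × Fin n) × (Fin m × Fin m))) ℂ) (h : ((Fin n × Fin n) →₀ ℕ) → MvPolynomial ((Option (Fin n × Fin n) × (Fin m × Fin m)) ⊕ (Option (Fin n × Fin n) × (Fin m × Fin m))) ℂ), (∀ i, (q i * cj (q i)).totalDegree ≤ d) ∧ (∀ μ, (h μ * eqn μ).totalDegree ≤ d) ∧ ∑ i, q i * cj (q i) + ∑ μ ∈ P.support, (h μ * eqn μ + cj (h μ * eqn μ)) + 1 = 0) :=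
  exists_sos_certificate_support_of_hasHermitianSosRefutationOfDegree_coeff _ d h

/-- **Registered stub `stub_sosRoute`** of line `Sketch` (crux `CertWindowQP`, stmt-ValiantsHypothesis-5640),
verbatim signature of the registered skeleton `Cruxes/CertWindowQP/Lines/Sketch.lean`; proved by the
theorem above. -/
theorem stub_sosRoute (n m d : ℕ)
    (h : HasHermitianSosRefutationOfDegree (fun μ : (Fin n × Fin n) →₀ ℕ => ((Matrix.of fun i j : Fin m => MvPolynomial.C (MvPolynomial.X (none, (i, j))) + ∑ e : Fin n × Fin n, MvPolynomial.X e * MvPolynomial.C (MvPolynomial.X (some e, (i, j))) : Matrix (Fin m) (Fin m) (MvPolynomial (Fin n × Fin n) (MvPolynomial (Option (Fin n × Fin n) × (Fin m × Fin m)) ℂ))).det - MvPolynomial.map MvPolynomial.C (Literature.Computability.AlgebraicComplexity.perPoly (Fin n) ℂ)).coeff μ) d) :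
    ∃ (k : ℕ) (q : Fin k → MvPolynomial ((Option (Fin n × Fin n) × (Fin m × Fin m)) ⊕ (Option (Fin n × Fin n) × (Fin m × Fin m))) ℂ) (h : ((Fin n × Fin n) →₀ ℕ) → MvPolynomial ((Option (Fin n × Fin n) × (Fin m × Fin m)) ⊕ (Option (Fin n × Fin n) × (Fin m × Fin m))) ℂ), (∀ i, (q i * MvPolynomial.rename Sum.swap (MvPolynomial.map (starRingEnd ℂ) (q i))).totalDegree ≤ d) ∧ (∀ μ, (h μ * MvPolynomial.rename Sum.inl (((Matrix.of fun i j : Fin m => MvPolynomial.C (MvPolynomial.X (none, (i, j))) + ∑ e : Fin n × Fin n, MvPolynomial.X e * MvPolynomial.C (MvPolynomial.X (some e, (i, j))) : Matrix (Fin m) (Fin m) (MvPolynomial (Fin n × Fin n) (MvPolynomial (Option (Fin n × Fin n) × (Fin m × Fin m)) ℂ))).det - MvPolynomial.map MvPolynomial.C (Literature.Computability.AlgebraicComplexity.perPoly (Fin n) ℂ)).coeff μ)).totalDegree ≤ d) ∧ ∑ i, q i * MvPolynomial.rename Sum.swap (MvPolynomial.map (starRingEnd ℂ) (q i)) + ∑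 μ ∈ ((Matrix.of fun i j : Fin m => MvPolynomial.C (MvPolynomial.X (none, (i, j))) + ∑ e : Fin n × Fin n, MvPolynomial.X e * MvPolynomial.C (MvPolynomial.X (some e, (i, j))) : Matrix (Fin m) (Fin m) (MvPolynomial (Fin n × Fin n) (MvPolynomial (Option (Fin n × Fin n) × (Fin m × Fin m)) ℂ))).det - MvPolynomial.map MvPolynomial.C (Literature.Computability.AlgebraicComplexity.perPoly (Fin n) ℂ)).support, (h μ * MvPolynomial.rename Sum.inl (((Matrix.of fun i j : Fin m => MvPolynomial.C (MvPolynomial.X (none, (i, j))) + ∑ e : Fin n × Fin n, MvPolynomial.X e * MvPolynomial.C (MvPolynomial.X (some e, (i, j))) : Matrix (Fin m) (Fin m) (MvPolynomial (Fin n × Fin n) (MvPolynomial (Option (Fin n × Fin n) × (Fin m × Fin m)) ℂ))).det - MvPolynomial.map MvPolynomial.C (Literature.Computability.AlgebraicComplexity.perPoly (Fin n) ℂ)).coeff μ) + MvPolynomial.rename Sum.swap (MvPolynomial.map (starRingEnd ℂ) (h μ * MvPolynomial.rename Sum.inl (((Matrix.of fun i j : Fin m => MvPolynomial.C (MvPolynomial.X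 (none, (i, j))) + ∑ e : Fin n × Fin n, MvPolynomial.X e * MvPolynomial.C (MvPolynomial.X (some e, (i, j))) : Matrix (Fin m) (Fin m) (MvPolynomial (Fin n × Fin n) (MvPolynomial (Option (Fin n × Fin n) × (Fin m × Fin m)) ℂ))).det - MvPolynomial.map MvPolynomial.C (Literature.Computability.AlgebraicComplexity.perPoly (Fin n) ℂ)).coeff μ)))) + 1 = 0 :=
  certWindowQP_sosRoute n m d h

end Summit.ValiantsHypothesis.ValiantsHypothesis.Theorems
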